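/-
Copyright (c) 2026 the pub-hodgecm-mathlib formalisation cell (harness21).  Prover seat hodgecm-mathlib-R90-C14-p01 (g0), HCML SLAB R90-TF,
section S3 «§12.7 endoscopic character identities» (base `R90-C12`), DEAL S3 WAVE 5 brick (W5-c) (successor S3 dealer R90-C12-plan (g2),
memo `R90/R90-C12-plan/g2/DEAL-S3-WAVE5-L492General.md`, R90 bus 2026-09-04T23:04:59Z).  2026-09-04.
-/
import Summits.HodgeConjecture.HodgeConjecture.Theorems.F0P2pTorusPairsAndVacuity        -- ★ `continuous_of_smoothInd_ne_zero`
import Literature.NumberTheory.Automorphic.UnitaryGroupPrincipalSeriesH                  -- ★ `cmPrincipalSeriesH`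
import Literature.NumberTheory.Automorphic.IrreducibleClassesConstituents                -- ★ `IrrClass.IsConstituentOf`, `nontrivial_of_isIrreducible`
import HarnessLib

/-!
# R90 · S3 — WAVE 5 brick (W5-c): a constituent of `i_H(χ₂ ⊠ χ₁)` forces `χ₂` to be continuous
# (`Theorems/R90S3ConstituentPSContinuous.lean`)

Cell `hodgecm-mathlib`, crux H413 (`stmt-HodgeConjecture-24833`), route of record `HCCMUnconditional`; programme R90-TF, section S3 (base `R90-C12`),
seat R90-C14-p01 (g0); DEAL S3 WAVE 5 (W5-c) (R90-C12-plan (g2) 23:04:59Z).  Helper lane `--supports stmt-HodgeConjecture-24833 --as helper`;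
TWO THEOREMS (no definition, no instance, no notation, no `sorry`).

THE MATHEMATICS [Rogawski1990, §12.1 p. 171; BernsteinZelevinsky1976, §2.21–2.23].  `i_H(χ₂ ⊠ χ₁) = cmPrincipalSeriesH L v χ₂ χ₁` lives on the space of
`i_{U(Φ₂)}(χ₂)` (the `U(Φ₁)_v`-factor acts by the scalar `χ₁`).  If a class `σ` is a CONSTITUENT of it, some subquotient `N₁ ⁄ N₂` is irreducible, hence
non-zero, so `N₁` contains a non-zero vector `f` of `i(χ₂)`; ★ `continuous_of_smoothInd_ne_zero` (a non-zero smooth vector of `i_P^G(χ)` forces `χ`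
continuous) gives the continuity of `χ₂`.  This is the `hχ₂ : Continuous` input of the signed Lemma 4.9.2 identity at general `(χ₂, χ₁)` (W5-a), read off the
premise «`∃ σ ∈ ρ, σ.IsConstituentOf (cmPrincipalSeriesH L v χ₂ χ₁)`» of E's socket `stub_R90_S3_print_492_indPS` (payer W5-d).
* **`continuous_of_isConstituentOf_cmPrincipalSeriesH`**.
HONEST LABEL: helper; pays no socket by itself.  HC_CM is proved only modulo the 7 printed citations (2 remaining named inputs: hLiu418 =
stmt-HodgeConjecture-24832, h413 = stmt-HodgeConjecture-24833) until rung 0 closes; count-neutral.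

## References
* [Rogawski1990] J. D. Rogawski, *Automorphic Representations of Unitary Groups in Three Variables* (1990), §12.1 p. 171.
* [BernsteinZelevinsky1976] I. N. Bernstein, A. V. Zelevinsky, *Representations of the group GL(n,F)*, Russ. Math. Surveys 31:3 (1976), §2.21–2.23.
-/

-- the mandated namespace repeats the single-problem summit's segment (`HodgeConjecture.HodgeConjecture`)
set_option linter.dupNamespace false
set_option autoImplicit false

noncomputable section

namespace Summit.HodgeConjecture.HodgeConjecture.R90.S3

open IsDedekindDomain NumberField
open Literature.NumberTheory Literature.NumberTheory.Automorphic Literature.NumberTheory.Automorphic.UnitaryGroup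
open Summit.HodgeConjecture.HodgeConjecture.Cruxes.H413.F0P2pTorusPairsAndVacuity (continuous_of_smoothInd_ne_zero)
open scoped Matrix

variable (L : Type) [Field L] [NumberField L] [IsCMField L] (v : HeightOneSpectrum (𝓞 ↥(maximalRealSubfield L)))

/-- A representation with a constituent is non-zero: some vector of the ambient space is `≠ 0` (the irreducible subquotient `N₁ ⁄ N₂` is
non-zero, so `N₁ ≠ 0`). [cite: BushnellHenniart2006, §1.1] -/
theorem exists_ne_zero_of_isConstituentOf {G : Type*} [Group G] [TopologicalSpace G] {V : Type*} [AddCommGroup V] [Module ℂ V]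
    {ρ : Representation ℂ G V} {c : IrrClass G} (h : c.IsConstituentOf ρ) : ∃ f : V, f ≠ 0 := by
  obtain ⟨r, -, N₁, N₂, -, ⟨e⟩⟩ := h
  haveI := r.isIrreducible
  haveI : Nontrivial r.V := IrrClass.nontrivial_of_isIrreducible r.ρ
  -- `N₁ ≠ 0`: otherwise the subquotient `N₁ ⁄ N₂ ≅ r` would be zero
  have hN₁ : N₁.toSubmodule ≠ ⊥ := by
    intro hbot
    have hsub : Subsingleton (↥N₁.toSubmodule ⧸ (N₂.toSubmodule.comap N₁.toSubmodule.subtype)) := by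
      refine ⟨fun a b => ?_⟩
      obtain ⟨x, rfl⟩ := Submodule.Quotient.mk_surjective _ a
      obtain ⟨y, rfl⟩ := Submodule.Quotient.mk_surjective _ b
      have hx : x = 0 := Subtype.ext ((Submodule.mem_bot ℂ).mp (hbot ▸ x.2))
      have hy : y = 0 := Subtype.ext ((Submodule.mem_bot ℂ).mp (hbot ▸ y.2))
      rw [hx, hy]
    exact not_subsingleton r.V e.toLinearEquiv.toEquiv.subsingleton
  obtain ⟨f, -, hf0⟩ := (Submodule.ne_bot_iff _).mp hN₁
  exact ⟨f, hf0⟩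

/-- **(W5-c) A constituent of `i_H(χ₂ ⊠ χ₁)` forces `χ₂` to be continuous**: if some class `σ` of `H_v = U(Φ₂)_v × U(Φ₁)_v` is a constituent of
`cmPrincipalSeriesH L v χ₂ χ₁`, then the inducing torus character `χ₂` is continuous (a constituent is a non-zero subquotient, so the induced space has a
non-zero smooth vector; ★ `continuous_of_smoothInd_ne_zero`). [cite: Rogawski1990, §12.1 p. 171] [cite: BernsteinZelevinsky1976, §2.21–2.23] -/
theorem continuous_of_isConstituentOf_cmPrincipalSeriesH
    (χ₂ : ↥(torusU (conjLocal L (IsCMField.complexConj L) v) (cmLocalForm L 2 v)) →* ℂˣ)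
    (χ₁ : (UnitaryGroup.cmDatum L 1 (Matrix.of fun i j : Fin 1 => if i.val + j.val + 1 = 1 then (1 : L) else 0)).Local v →* ℂˣ)
    (σ : IrrClass ((UnitaryGroup.cmDatum L 2 (Matrix.of fun i j : Fin 2 => if i.val + j.val + 1 = 2 then (1 : L) else 0)).Local v ×
      (UnitaryGroup.cmDatum L 1 (Matrix.of fun i j : Fin 1 => if i.val + j.val + 1 = 1 then (1 : L) else 0)).Local v))
    (hσ : σ.IsConstituentOf (cmPrincipalSeriesH L v χ₂ χ₁)) :
    Continuous fun t : ↥(torusU (conjLocal L (IsCMField.complexConj L) v) (cmLocalForm L 2 v)) => ((χ₂ t : ℂˣ) : ℂ) := by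
  obtain ⟨f, hf0⟩ := exists_ne_zero_of_isConstituentOf hσ
  haveI := locallyCompactSpace_cmBorelU L 2 v
  exact continuous_of_smoothInd_ne_zero (cmBorelTriple L 2 v) χ₂ f hf0

end Summit.HodgeConjecture.HodgeConjecture.R90.S3

end
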